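import Summits.CriticalPhenomena.PercolationContinuityZ3.Theorems.PercNearOneGluingNoHeavyLowerTailThreePointIsoSexticUniversal
import Summits.CriticalPhenomena.PercolationContinuityZ3.Theorems.PercNearOneGluingNoHeavyLowerTailThreePointIsoSexticFace
import Summits.CriticalPhenomena.PercolationContinuityZ3.Theorems.PercNearOneGluingNoHeavyLowerTailPolarizedThreePointLB
import HarnessLib

/-!
# Corollaries of the sextic isolation law `(Q6)` on every finite weighted graph: `(Q4)` and the face inequality `(C½)` in event form

Support file for crux `stmt-CriticalPhenomena-4575` (`NoHeavyLowerTail`), seat `prim-facecert` gen 20/21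
(`--supports stmt-CriticalPhenomena-4575`).  No definitions, no sorries, standard axioms.

The port component of `(Q6)` — `P(a|b|c)⁶ ≤ P(c ↮ {a,b})² · P(b ↮ {a,c})³ · P(a ↮ {b,c})³` for ALL finite weighted graphs and all
`a b c` — is the tree's `ThreePointIsoSexticUniversal.isoSexticPort_all` (prim-l12-p1 gen 24, one-pair pivot induction).  (An independent
proof by contraction of sure pairs — `…EdgeContraction`, `…ThreePointIsoSexticSteps` — was this seat's gen-20 route; its final assembly is
not restated here.)  This file records two consequences used by the lane:
* `isoQuartic_graph` — the quartic law `(Q4)`: `P(a|b|c)⁴ ≤ P(c↮{a,b})·P(b↮{a,c})²·P(a↮{b,c})²` on every finite weighted graph;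
* `ThreePointFaceHalfAllGraphs.faceHalf_graph` — the face inequality `(C½)` in event form,
  `3·P(a↔b, a↔c) ≤ (1 + 2·P(a↔b))·P(a↔c ∨ b↔c)`, i.e. `P(a↔b ∣ c↔{a,b}) ≤ (1 + 2P(a↔b))/3`, on every finite weighted graph
  (via `ThreePointIsoSexticFace.face_half_of_isoSexticPort'` and the five-cell dictionary `PolarizedThreePointLB.cells_eq`), so the
  tower/fan fixed point `λ* = ½` is exact (towers give sharpness).
[cite: VandenbergHaggstromKahn2005, Thm. 1.3 (p. 6)]; [cite: Grimmett1999, §1.6, §2.2]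
-/

noncomputable section

namespace Summit.CriticalPhenomena.PercolationContinuityZ3.Theorems.ThreePointIsoSexticAllGraphs

open MeasureTheory Set
open Literature.Probability.Percolation
open Literature.Probability.LatticeModels (prodBernoulli)
open scoped Classical

variable {V : Type*} [Fintype V]

/-! ## Corollary: the quartic isolation law `(Q4)` on every finite weighted graph -/

section Quartic

/-- **`(Q4)` on every finite weighted graph**: `P(a|b|c)⁴ ≤ P(c ↮ {a,b}) · P(b ↮ {a,c})² · P(a ↮ {b,c})²` — the monomial law of
prim-l12-p1 gen 21 (`…ThreePointIsoQuartic`, there proved on parallel compositions of `(K)`-pieces and left open in general).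
From `(Q6)_c` and `Q ≤ I_a, I_b`: `Q⁸ = Q⁶·Q² ≤ (I_c²I_b³I_a³)(I_bI_a) = (I_cI_b²I_a²)²`. [this work] -/
theorem isoQuartic_graph (w : Sym2 V → unitInterval) (a b c : V) :
    (prodBernoulli w).real ((openConn a b)ᶜ ∩ (openConn a c)ᶜ ∩ (openConn b c)ᶜ) ^ 4 ≤
      (prodBernoulli w).real ((openConn a c)ᶜ ∩ (openConn b c)ᶜ) *
        (prodBernoulli w).real ((openConn a b)ᶜ ∩ (openConn b c)ᶜ) ^ 2 *
          (prodBernoulli w).real ((openConn a b)ᶜ ∩ (openConn a c)ᶜ) ^ 2 := by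
  have h6 := ThreePointIsoSexticUniversal.isoSexticPort_all w a b c
  set Q := (prodBernoulli w).real ((openConn a b)ᶜ ∩ (openConn a c)ᶜ ∩ (openConn b c)ᶜ)
  set A := (prodBernoulli w).real ((openConn a b)ᶜ ∩ (openConn a c)ᶜ)
  set B := (prodBernoulli w).real ((openConn a b)ᶜ ∩ (openConn b c)ᶜ)
  set C := (prodBernoulli w).real ((openConn a c)ᶜ ∩ (openConn b c)ᶜ)
  have hQ : 0 ≤ Q := measureReal_nonneg
  have hA : 0 ≤ A := measureReal_nonneg
  have hB : 0 ≤ B := measureReal_nonneg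
  have hC : 0 ≤ C := measureReal_nonneg
  have hQA : Q ≤ A := measureReal_mono inter_subset_left
  have hQB : Q ≤ B := measureReal_mono (by rintro ω ⟨⟨h1, -⟩, h3⟩; exact ⟨h1, h3⟩)
  have h8 : (Q ^ 4) ^ 2 ≤ (C * B ^ 2 * A ^ 2) ^ 2 := by
    have e1 : (Q ^ 4) ^ 2 = Q ^ 6 * (Q * Q) := by ring
    have e2 : (C * B ^ 2 * A ^ 2) ^ 2 = (C ^ 2 * B ^ 3 * A ^ 3) * (B * A) := by ring
    rw [e1, e2]
    exact mul_le_mul h6 (mul_le_mul hQB hQA hQ hB) (mul_nonneg hQ hQ) (by positivity)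
  exact (pow_le_pow_iff_left₀ (pow_nonneg hQ 4) (by positivity) two_ne_zero).1 h8

end Quartic
end Summit.CriticalPhenomena.PercolationContinuityZ3.Theorems.ThreePointIsoSexticAllGraphs

namespace Summit.CriticalPhenomena.PercolationContinuityZ3.Theorems.ThreePointFaceHalfAllGraphs

open MeasureTheory Set
open Literature.Probability.Percolation
open Literature.Probability.LatticeModels (prodBernoulli)
open Summit.CriticalPhenomena.PercolationContinuityZ3.Theorems.ThreePointIsoSexticAllGraphs
open scoped Classical

variable {V : Type*} [Fintype V]

/-- **The face inequality `(C½)` holds on EVERY finite weighted graph**: for all vertices `a, b, c`,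

  `3·P(a ↔ b, a ↔ c) ≤ (1 + 2·P(a ↔ b)) · P(c ↔ {a,b})`,

i.e. `P(a ↔ b ∣ c ↔ {a,b}) ≤ (1 + 2·P(a ↔ b))/3` — conditioning on `c` touching `{a,b}` closes at most one third of the gap
`1 − P(a ↔ b)`; equivalently `Cov(1_{c↔{a,b}}, 1_{a↔b}) ≤ ½·P(c joins exactly one of a, b)`, the `λ = ½` face inequality, so the
fixed point `λ* = ½` of the tower/fan constructions (prim-nh-lead-4575 gen 115, prim-l12-p1 gen 21) is EXACT.  Proof: the port
component of `(Q6)` (`ThreePointIsoSexticUniversal.isoSexticPort_all`) and the pointwise lemma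
`ThreePointIsoSexticFace.face_half_of_isoSexticPort'`, through the five-cell dictionary `PolarizedThreePointLB.cells_eq`. [this work] -/
theorem faceHalf_graph (w : Sym2 V → unitInterval) (a b c : V) :
    3 * (prodBernoulli w).real (openConn a b ∩ openConn a c) ≤
      (1 + 2 * (prodBernoulli w).real (openConn a b)) * (prodBernoulli w).real (openConn a c ∪ openConn b c) := by
  have hself : ∀ x : V, (openConn x x : Set (BondConfig V)) = univ := fun x =>
    eq_univ_of_forall fun ω => (SimpleGraph.Reachable.refl x : (openGraph ω).Reachable x x)
  have hle1 : ∀ A : Set (BondConfig V), (prodBernoulli w).real A ≤ 1 := fun A => measureReal_le_one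
  -- degenerate triples
  by_cases hab : a = b
  · subst hab
    rw [hself, univ_inter, probReal_univ]
    have : (openConn a c ∪ openConn a c : Set (BondConfig V)) = openConn a c := union_self _
    rw [this]; linarith [measureReal_nonneg (μ := prodBernoulli w) (s := (openConn a c : Set (BondConfig V)))]
  by_cases hac : a = c
  · subst hac
    rw [hself, inter_univ, univ_union, probReal_univ]
    linarith [hle1 (openConn a b)]
  by_cases hbc : b = c
  · subst hbc
    rw [hself, union_univ, probReal_univ, inter_self, mul_one]
    linarith [hle1 (openConn a b)]
  -- the sextic law, the dictionary, and the face lemma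
  have h6 := ThreePointIsoSexticUniversal.isoSexticPort_all w a b c
  obtain ⟨-, -, -, cA, cB, cC, cQ, -, -, -⟩ := PolarizedThreePointLB.cells_eq w a b c
  have hU : (prodBernoulli w).real (openConn a c ∪ openConn b c) =
      (prodBernoulli w).real (openConn a c) + (prodBernoulli w).real (openConn b c) -
        (prodBernoulli w).real (openConn a b ∩ openConn a c) := by
    have h := measureReal_union_add_inter (μ := prodBernoulli w) (s := (openConn a c : Set (BondConfig V)))
      (t := openConn b c) MeasurableSet.of_discrete
    rw [PolarizedThreePointLB.openConn_inter_ac_bc] at h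
    linarith
  set Q := (prodBernoulli w).real ((openConn a b)ᶜ ∩ (openConn a c)ᶜ ∩ (openConn b c)ᶜ) with hQ
  set A := (prodBernoulli w).real ((openConn a b)ᶜ ∩ (openConn a c)ᶜ) with hA
  set B := (prodBernoulli w).real ((openConn a b)ᶜ ∩ (openConn b c)ᶜ) with hB
  set C := (prodBernoulli w).real ((openConn a c)ᶜ ∩ (openConn b c)ᶜ) with hC
  have hQ0 : 0 ≤ Q := measureReal_nonneg
  have hQA : Q ≤ A := measureReal_mono inter_subset_left
  have hQB : Q ≤ B := measureReal_mono (by rintro ω ⟨⟨h1, -⟩, h3⟩; exact ⟨h1, h3⟩)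
  have hQC : Q ≤ C := measureReal_mono (by rintro ω ⟨⟨-, h2⟩, h3⟩; exact ⟨h2, h3⟩)
  have hface := ThreePointIsoSexticFace.face_half_of_isoSexticPort' (q := Q) (s := C - Q) (t := B - Q) (u := A - Q)
    hQ0 (sub_nonneg.2 hQC) (sub_nonneg.2 hQB) (sub_nonneg.2 hQA) (by
      have e : (Q + (A - Q)) ^ 3 * (Q + (B - Q)) ^ 3 * (Q + (C - Q)) ^ 2 = C ^ 2 * B ^ 3 * A ^ 3 := by ring
      rw [e]; exact h6)
  rw [hU]
  rw [cA, cB, cC, cQ] at hface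
  nlinarith [hface]

end Summit.CriticalPhenomena.PercolationContinuityZ3.Theorems.ThreePointFaceHalfAllGraphs
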